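import Literature.NumberTheory.LFunctions.WeilCombProgressionSums
import HarnessLib

/-!
# Node weights of `ζ`-mollified combs, sharp evaluation III: the family weight `s ↦ B(c/s)/s`

Topic `Literature/NumberTheory/LFunctions`.  Companion of
`Literature/NumberTheory/LFunctions/WeilCombProgressionSums.lean`: the weight carried by one family
`j = gm` of the lattice organisation of a node weight is `f_m(k') = B(mK₀/k')/k'`, i.e. `s ↦ B(c/s)/s`
with `c = mK₀ ≠ 0`, for the `C²` bump autocorrelation `B` (`|B| ≤ N₀`, `|B'| ≤ N₁`, vanishing for
`|x| > 2`).  This file proves that it satisfies the hypotheses of `abs_sum_prog_sub_integral_le`: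

* `deriv_bump_eq_zero`, `bump_comp_div_eq_zero` — `B' = 0` where `|x| > 2`; `B(c/s) = B'(c/s) = 0`
  for `0 < |s| < |c|/2`;
* `hasDerivAt_familyWeight`, `continuous_familyWeight_deriv` — `f` is `C¹` on all of `ℝ` (it
  vanishes identically near `0`);
* `abs_familyWeight_le`, `abs_familyWeight_deriv_le` — `|f| ≤ 2N₀/|c|` on `[0, ∞)`,
  `|f'(s)| ≤ 4(2N₁ + N₀)/(s + |c|/2)²` on `(0, ∞)`;
* `abs_familySum_sub_integral_le` — hence, for `P ≥ 1`, `Q` coprime to `P`, `m ∈ ℤ`, `N : ℕ`: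
  `|∑_{k ≤ N, P ∣ m + Qk} B(c/k)/k - (1/P) ∫_0^N B(c/s)/s ds| ≤ (16N₁ + 14N₀)/|c|`.

Everything is proved; no named facts (folklore real analysis).
-/

noncomputable section

open MeasureTheory Set intervalIntegral Filter
open scoped Topology

namespace Literature.NumberTheory.LFunctions

/-! ## The family weight `s ↦ B(c/s)/s` -/

section FamilyWeight

variable {B B' : ℝ → ℝ} {N₀ N₁ : ℝ}

/-- If `B` vanishes for `|x| > 2`, so does its derivative. [folklore] -/
theorem deriv_bump_eq_zero (hB : ∀ x, HasDerivAt B (B' x) x) (hBs : ∀ x, 2 < |x| → B x = 0)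
    {x : ℝ} (hx : 2 < |x|) : B' x = 0 := by
  have hopen : IsOpen {y : ℝ | 2 < |y|} := isOpen_lt continuous_const continuous_abs
  have hev : B =ᶠ[𝓝 x] fun _ ↦ (0 : ℝ) := by
    filter_upwards [hopen.mem_nhds hx] with y hy
    exact hBs y hy
  have h0 : HasDerivAt B 0 x := (hasDerivAt_const x (0 : ℝ)).congr_of_eventuallyEq hev
  exact (hB x).unique h0

/-- Near `0` the family weight and its derivative formula vanish: for `c ≠ 0` and `|s| < |c|/2`,
`B(c/s) = 0` and `B'(c/s) = 0` unless `s = 0`. [folklore] -/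
theorem bump_comp_div_eq_zero (hB : ∀ x, HasDerivAt B (B' x) x) (hBs : ∀ x, 2 < |x| → B x = 0)
    {c s : ℝ} (hs : s ≠ 0) (hsc : |s| < |c| / 2) : B (c / s) = 0 ∧ B' (c / s) = 0 := by
  have habs : 2 < |c / s| := by
    rw [abs_div, lt_div_iff₀ (abs_pos.2 hs)]
    linarith
  exact ⟨hBs _ habs, deriv_bump_eq_zero hB hBs habs⟩

/-- **Derivative of the family weight**: with `f(s) = B(c/s)/s` and
`f'(s) = (B'(c/s)·(c·(-(s²)⁻¹))·s - B(c/s))/s²`, `HasDerivAt f (f' s) s` at EVERY `s` (`c ≠ 0`;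
near `s = 0` both vanish identically). [folklore] -/
theorem hasDerivAt_familyWeight (hB : ∀ x, HasDerivAt B (B' x) x) (hBs : ∀ x, 2 < |x| → B x = 0)
    {c : ℝ} (hc : c ≠ 0) (s : ℝ) :
    HasDerivAt (fun s ↦ B (c / s) / s)
      ((B' (c / s) * (c * -(s ^ 2)⁻¹) * s - B (c / s)) / s ^ 2) s := by
  rcases eq_or_ne s 0 with rfl | hs
  · -- locally zero near `0`
    have hc2 : 0 < |c| / 2 := by have := abs_pos.2 hc; positivity
    have hev : (fun s ↦ B (c / s) / s) =ᶠ[𝓝 0] fun _ ↦ (0 : ℝ) := by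
      filter_upwards [Ioo_mem_nhds (by linarith : -(|c| / 2) < 0) hc2] with y hy
      rcases eq_or_ne y 0 with rfl | hy0
      · simp
      · rw [(bump_comp_div_eq_zero hB hBs hy0 (abs_lt.2 hy)).1, zero_div]
    have h0 : HasDerivAt (fun s ↦ B (c / s) / s) 0 0 :=
      (hasDerivAt_const (0 : ℝ) (0 : ℝ)).congr_of_eventuallyEq hev
    simpa using h0
  · have h1 : HasDerivAt (fun y ↦ c * y⁻¹) (c * -(s ^ 2)⁻¹) s := (hasDerivAt_inv hs).const_mul c
    have h2 : HasDerivAt (fun y ↦ B (c * y⁻¹)) (B' (c * s⁻¹) * (c * -(s ^ 2)⁻¹)) s :=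
      (hB _).comp s h1
    have h3 := h2.div (hasDerivAt_id s) hs
    simp only [id, mul_one, ← div_eq_mul_inv] at h3
    exact h3

/-- **The derivative formula is continuous** (continuous away from `0`, identically zero near `0`).
[folklore] -/
theorem continuous_familyWeight_deriv {B'' : ℝ → ℝ} (hB : ∀ x, HasDerivAt B (B' x) x)
    (hB' : ∀ x, HasDerivAt B' (B'' x) x) (hBs : ∀ x, 2 < |x| → B x = 0) {c : ℝ} (hc : c ≠ 0) :
    Continuous fun s ↦ (B' (c / s) * (c * -(s ^ 2)⁻¹) * s - B (c / s)) / s ^ 2 := by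
  have hBc : Continuous B := continuous_iff_continuousAt.2 fun x ↦ (hB x).continuousAt
  have hB'c : Continuous B' := continuous_iff_continuousAt.2 fun x ↦ (hB' x).continuousAt
  refine continuous_iff_continuousAt.2 fun s ↦ ?_
  rcases eq_or_ne s 0 with rfl | hs
  · have hc2 : 0 < |c| / 2 := by have := abs_pos.2 hc; positivity
    have hev : (fun s ↦ (B' (c / s) * (c * -(s ^ 2)⁻¹) * s - B (c / s)) / s ^ 2)
        =ᶠ[𝓝 0] fun _ ↦ (0 : ℝ) := by
      filter_upwards [Ioo_mem_nhds (by linarith : -(|c| / 2) < 0) hc2] with y hy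
      rcases eq_or_ne y 0 with rfl | hy0
      · simp
      · obtain ⟨h1, h2⟩ := bump_comp_div_eq_zero hB hBs hy0 (abs_lt.2 hy)
        rw [h1, h2]; simp
    exact continuousAt_const.congr hev.symm
  · have hcs : ContinuousAt (fun y : ℝ ↦ c / y) s := continuousAt_const.div continuousAt_id hs
    refine ContinuousAt.div ?_ (continuousAt_id.pow 2) (pow_ne_zero 2 hs)
    refine ((((hB'c.continuousAt).comp hcs).mul (continuousAt_const.mul ?_)).mul continuousAt_id).sub
      ((hBc.continuousAt).comp hcs)
    exact (continuousAt_id.pow 2).inv₀ (pow_ne_zero 2 hs) |>.neg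

/-- **Size of the family weight**: `|B(c/s)/s| ≤ 2N₀/|c|` for `s ≥ 0` (`|B| ≤ N₀`). [folklore] -/
theorem abs_familyWeight_le (hB : ∀ x, HasDerivAt B (B' x) x) (h0 : ∀ x, |B x| ≤ N₀)
    (hBs : ∀ x, 2 < |x| → B x = 0) {c : ℝ} (hc : c ≠ 0) {s : ℝ} (hs : 0 ≤ s) :
    |B (c / s) / s| ≤ 2 * N₀ / |c| := by
  have hN₀ : 0 ≤ N₀ := (abs_nonneg _).trans (h0 0)
  have hc0 : 0 < |c| := abs_pos.2 hc
  rcases eq_or_lt_of_le hs with rfl | hs0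
  · simp; positivity
  by_cases hsc : s < |c| / 2
  · rw [(bump_comp_div_eq_zero hB hBs (c := c) hs0.ne' (by rwa [abs_of_pos hs0])).1, zero_div,
      abs_zero]
    positivity
  · have hsc' : |c| / 2 ≤ s := not_lt.1 hsc
    rw [abs_div, abs_of_pos hs0, div_le_div_iff₀ hs0 hc0]
    calc |B (c / s)| * |c| ≤ N₀ * |c| := mul_le_mul_of_nonneg_right (h0 _) hc0.le
      _ ≤ N₀ * (2 * s) := mul_le_mul_of_nonneg_left (by linarith [hsc']) hN₀
      _ = 2 * N₀ * s := by ring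

/-- **Size of the derivative**: `|f'(s)| ≤ 4(2N₁ + N₀)/(s + |c|/2)²` for `s > 0`. [folklore] -/
theorem abs_familyWeight_deriv_le (hB : ∀ x, HasDerivAt B (B' x) x) (h0 : ∀ x, |B x| ≤ N₀)
    (h1 : ∀ x, |B' x| ≤ N₁) (hBs : ∀ x, 2 < |x| → B x = 0) {c : ℝ} (hc : c ≠ 0) {s : ℝ}
    (hs : 0 < s) :
    |(B' (c / s) * (c * -(s ^ 2)⁻¹) * s - B (c / s)) / s ^ 2|
      ≤ 4 * (2 * N₁ + N₀) / (s + |c| / 2) ^ 2 := by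
  have hN₀ : 0 ≤ N₀ := (abs_nonneg _).trans (h0 0)
  have hN₁ : 0 ≤ N₁ := (abs_nonneg _).trans (h1 0)
  have hc0 : 0 < |c| := abs_pos.2 hc
  by_cases hsc : s < |c| / 2
  · obtain ⟨e1, e2⟩ := bump_comp_div_eq_zero hB hBs (c := c) hs.ne' (by rwa [abs_of_pos hs])
    rw [e1, e2]
    simp only [zero_mul, sub_zero, zero_div, abs_zero]
    positivity
  · have hsc' : |c| / 2 ≤ s := not_lt.1 hsc
    have hs2 : 0 < s ^ 2 := by positivity
    -- simplify the formula: `(B'·(c·(-1/s²))·s - B)/s² = -(B'·(c/s) + B)/s²`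
    have hform : (B' (c / s) * (c * -(s ^ 2)⁻¹) * s - B (c / s)) / s ^ 2
        = -(B' (c / s) * (c / s) + B (c / s)) / s ^ 2 := by
      field_simp
      ring
    rw [hform, abs_div, abs_neg, abs_of_pos hs2]
    -- numerator `≤ 2N₁ + N₀`
    have hnum : |B' (c / s) * (c / s) + B (c / s)| ≤ 2 * N₁ + N₀ := by
      by_cases hcs : 2 < |c / s|
      · rw [hBs _ hcs, deriv_bump_eq_zero hB hBs hcs]
        simp only [zero_mul, add_zero, abs_zero]
        positivity
      · have hcs' : |c / s| ≤ 2 := not_lt.1 hcs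
        calc |B' (c / s) * (c / s) + B (c / s)| ≤ |B' (c / s) * (c / s)| + |B (c / s)| := abs_add_le _ _
          _ = |B' (c / s)| * |c / s| + |B (c / s)| := by rw [abs_mul]
          _ ≤ N₁ * 2 + N₀ := add_le_add (mul_le_mul (h1 _) hcs' (abs_nonneg _) hN₁) (h0 _)
          _ = 2 * N₁ + N₀ := by ring
    -- `1/s² ≤ 4/(s + |c|/2)²` since `s + |c|/2 ≤ 2s`
    have hden : (s + |c| / 2) ^ 2 ≤ 4 * s ^ 2 := by nlinarith [hsc', hc0]
    have hpos : 0 < (s + |c| / 2) ^ 2 := by positivity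
    rw [div_le_div_iff₀ hs2 hpos]
    calc |B' (c / s) * (c / s) + B (c / s)| * (s + |c| / 2) ^ 2 ≤ (2 * N₁ + N₀) * (4 * s ^ 2) :=
          mul_le_mul hnum hden hpos.le (by positivity)
      _ = 4 * (2 * N₁ + N₀) * s ^ 2 := by ring

end FamilyWeight

/-! ## The family sum against the integral -/

/-- **One family of the lattice against its integral.** For a `C²` bump autocorrelation `B`
(`|B| ≤ N₀`, `|B'| ≤ N₁`, vanishing for `|x| > 2`), `c ≠ 0`, `P ≥ 1`, `Q` coprime to `P`, an
integer `m` and `N : ℕ`: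
`|∑_{k ≤ N, P ∣ m + Qk} B(c/k)/k - (1/P) ∫_0^N B(c/s)/s ds| ≤ (16N₁ + 14N₀)/|c|`. [folklore] -/
theorem abs_familySum_sub_integral_le {B B' B'' : ℝ → ℝ} {N₀ N₁ : ℝ}
    (hB : ∀ x, HasDerivAt B (B' x) x) (hB' : ∀ x, HasDerivAt B' (B'' x) x)
    (h0 : ∀ x, |B x| ≤ N₀) (h1 : ∀ x, |B' x| ≤ N₁) (hBs : ∀ x, 2 < |x| → B x = 0)
    {c : ℝ} (hc : c ≠ 0) {P Q : ℕ} (hP : 1 ≤ P) (hQP : Nat.Coprime Q P) (m : ℤ) (N : ℕ) :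
    |∑ k ∈ (Finset.Icc 1 N).filter (fun k : ℕ ↦ (P : ℤ) ∣ m + Q * k), B (c / k) / k
        - 1 / P * ∫ s in (0 : ℝ)..N, B (c / s) / s| ≤ (16 * N₁ + 14 * N₀) / |c| := by
  have hN₀ : 0 ≤ N₀ := (abs_nonneg _).trans (h0 0)
  have hN₁ : 0 ≤ N₁ := (abs_nonneg _).trans (h1 0)
  have hc0 : 0 < |c| := abs_pos.2 hc
  obtain ⟨r, T, hr1, hrP, hTup, hTlow, hsum⟩ := exists_prog_param hP hQP m N
  rw [hsum (fun k ↦ B (c / k) / k)]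
  have hmain := abs_sum_prog_sub_integral_le (f := fun s ↦ B (c / s) / s)
    (f' := fun s ↦ (B' (c / s) * (c * -(s ^ 2)⁻¹) * s - B (c / s)) / s ^ 2)
    (D := 2 * N₁ + N₀) (S := 2 * N₀ / |c|) (s₀ := |c| / 2) (N := (N : ℝ)) (P := P) (r := r) (T := T)
    (hasDerivAt_familyWeight hB hBs hc) (continuous_familyWeight_deriv hB hB' hBs hc)
    (by positivity) (by positivity)
    (fun s hs ↦ abs_familyWeight_deriv_le hB h0 h1 hBs hc hs)
    (fun s hs ↦ abs_familyWeight_le hB h0 hBs hc hs)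
    hP hr1 hrP (Nat.cast_nonneg N) (by exact_mod_cast hTup)
    (fun hT ↦ by have := hTlow hT; exact_mod_cast this)
  have hcast : ∀ t : ℕ, ((r + P * t : ℕ) : ℝ) = (r : ℝ) + P * t := fun t ↦ by push_cast; ring
  simp only [hcast]
  refine hmain.trans (le_of_eq ?_)
  field_simp
  ring

end Literature.NumberTheory.LFunctions
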